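import Summits.BirchSwinnertonDyer.BirchSwinnertonDyer.Theorems.PrintX8SmallImageMuReading
import Summits.BirchSwinnertonDyer.BirchSwinnertonDyer.Theorems.PrintX8SharpFlatRankZeroRoad
import Summits.BirchSwinnertonDyer.BirchSwinnertonDyer.Theses.PrintX8
import HarnessLib

/-!
# Route `PrintX8`, crux `SharpFlatMainConjectureSmallImageX8` (stmt-BirchSwinnertonDyer-20402) at
# ANALYTIC RANK `0`: GIVEN K1, on the small-image X8 pairs Sprung's Main Conjecture 7.21 ⟺ Miller's
# `BSD(E,3)` ⟸ Miller's UPPER bound — the `Λ`-adic crux has NO surplus over the Miller-currency residual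
# on 60 of its 61 cells (cell `bsd-print-x8`, D-0131 (2) print tier, prover seat p3; `--supports`
# 20402, closes nothing)

PARTITION (cell bsd-print-x8, leaf `ClassX8`; the 61 small-image cells of ty3's
`x8_smallimage_61cells.tsv`: 60 of analytic rank `0`, 1 of rank `1`): types-the-object-of the crux at
rank `0`; closes NONE; 0 census cells move; BSD is not proved by any of this.

HONEST FRAMING. K3's `K1Branch.sprungSharpFlatMainConjecture_of_bsdp` (`…RankZeroBranch.lean`) turns a
settled `BSD(E,3)` into Sprung's main conjecture at an X8 pair of rank `0` WITH `Surj W 3` (Kato's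
integral divisibility, Sprung 2012 Thm. 7.16 `n = 0` by Wuthrich 2014 Lemma 20). THIS file removes the
image datum by trading Kato for K1: with file A's reading `char X^• = (3^m · L^•)` (K1's predicate +
Thm. 7.16 FIRST clause), the Euler-characteristic identity (K•) for the generator `3^m · L^•` (Sprung
2024 Lemmas 5.5–5.9 at all levels, `lem59AllN`, flag `Sprung24-§5.2-allN-via-RaySprung25`) and the
unit-normalised interpolation `(w·L^•)(0) = L(E,1)/Ω_E` (b2b's `exists_units_interpolation_chromaticL`:
Sprung 2017 Cor. 4.11 + the period unit at `3`) read in `3`-adic valuations: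
`m + ord_3 L^•(0) = ord_3 ∏c_ℓ + ord_3 #Ш` and `ord_3 L^•(0) = ord_3 ∏c_ℓ + ord_3 #Ш_an`, so Miller's
UPPER bound `ord_3 #Ш ≤ ord_3 #Ш_an` (`MissingUpperBoundAt W 3`) forces `m = 0`:

* `X8.sprungSharpFlatMainConjecture_of_lowerDivisibility_of_missingUpperBoundAt` — **X8 ∧ `r_an = 0`,
  ANY image, colour `•`: K1's predicate + `MissingUpperBoundAt W 3` ⇒ Main Conj. 7.21 for `•`**;
  `…_of_bsdp_of_analyticRank_eq_zero` — the same from a settled `BSDp W 3`: at each of the 60 rank-`0`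
  small-image census cells carrying a per-pair `BSDp` theorem, the ♯/♭ main conjecture follows from K1
  ALONE;
* `sharpFlatMainConjecture_smallImage_rankZero_iff_bsdp_of_K1` — CLASS: given K1 BY NAME and the
  print, on the small-image X8 pairs of rank `0`, (∀ •, Main Conj. 7.21) ⟺ `BSD(E,3)` (⇒ is p1's
  image-free rank-zero road `X8MainConjectureRoad.…`, Sprung 2024 §5.2);
* `sharpFlatMainConjectureSmallImageX8_iff_bsdp_rankZero_and_mainConjecture_rankOne_of_K1` — **THE
  ANATOMY OF 20402: given K1 and the print, 20402 ⟺ (`BSD(E,3)` on the small-image pairs of rank `0`)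
  ∧ (Main Conj. 7.21 on the small-image pairs of rank `1`)** — the route's `Λ`-adic residual coincides
  with p2's Miller-currency residual R2 (`CornerX8Print`) at rank `0`; its only genuinely `Λ`-adic
  content is the rank-`1` small-image pairs (1 census cell), where by file A it is the `μ`-bound.
Beyond-print theorem: NO (compositions modulo named facts, conditional on K1). PARTITION: 0 cells.

References: [Sprung2012] Thm. 7.14, 7.16, Main Conj. 7.21 (pp. 1504–1505); [Sprung2024] Thm. 5.3, §5.2
Lemmas 5.5–5.9 (pp. 38–41); [Sprung2017] Cor. 4.11; [RaySprung2025] p. 2343; [Miller2011LMS] Def. 1.1;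
[Mazur1978] Cor. 4.1; [GreenbergVatsal2000] §3 Rem. 3.4; files `Theorems/PrintX8SmallImageMuReading.lean`
(p539576), `Theorems/PrintX8SharpFlatRankZeroRoad.lean` (p533869),
`Theorems/SignedLowerHalvesSprungLowerDivisibilityAtThreeRankZeroBranch.lean` (K1Branch),
`Rank1Residual/Supersingular/SharpFlatConverseReal.lean`, `…/SignedRankZero.lean`.
-/

set_option autoImplicit false
-- justification: the mandated namespace `Summit.BirchSwinnertonDyer.BirchSwinnertonDyer.Theorems`
-- (single-conjunct summit, Sub = Summit) repeats a segment by design (D-0017).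
set_option linter.dupNamespace false

noncomputable section

open scoped Classical NumberField MatrixGroups ModularForm
open NumberField IsDedekindDomain WeierstrassCurve CongruenceSubgroup
  Literature.NumberTheory.EllipticCurves Literature.NumberTheory.EllipticCurves.ModularForms
  Literature.NumberTheory.EllipticCurves.Rank1Residual
  Literature.NumberTheory.EllipticCurves.Rank1Residual.Typed
  Literature.NumberTheory.EllipticCurves.Sprung2017 Literature.NumberTheory.EllipticCurves.Sprung2012
  Literature.NumberTheory.EllipticCurves.Sprung2024
  Literature.NumberTheory.EllipticCurves.ZpExtension
  Summit.BirchSwinnertonDyer.BirchSwinnertonDyer.Theorems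
  Summit.BirchSwinnertonDyer.BirchSwinnertonDyer.Theorems.PrintX8MuReading

namespace Summit.BirchSwinnertonDyer.BirchSwinnertonDyer.Theorems.PrintX8SmallImageRankZero

open Summit.BirchSwinnertonDyer Summit.BirchSwinnertonDyer.Rank1Residual.Supersingular
  Literature.NumberTheory.EllipticCurves.BurungaleTian2026

/-! ### Analytic rank `0`: on the small-image X8 pairs the `μ`-bound (⟺ Main Conj. 7.21 given K1)
⟺ Miller's UPPER bound `ord_3 #Ш ≤ ord_3 #Ш_an` ⟺ `BSD(E,3)` — the `Λ`-adic crux carries NO surplus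
over Miller's currency at rank `0` (60 of the 61 small-image cells) -/

section RankZero

/-- **X8 ∧ `r_an = 0`, ANY image, colour `•`: K1's predicate + Miller's UPPER bound
`MissingUpperBoundAt W 3` (`ord_3 #Ш ≤ ord_3 #Ш_an`) ⇒ Sprung's Main Conjecture 7.21 for `•`.**
Named inputs (published): Sprung 2012 Thm. 7.14 (`h714`), Thm. 7.16 FIRST clause (`h716`, no image
hypothesis), Sprung 2024 Lemmas 5.5–5.9 at all levels (`h59`, (K•): `gen(0) ∼ #Sel·∏c_ℓ`), the period unit
at `3` (`h3`), GZK, modularity. Proof: by the `μ`-reading `char X^• = (3^m L^•)`; (K•) for the generator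
`3^m L^•` and the unit-normalised interpolation `(w L^•)(0) = L(E,1)/Ω_E` (`exists_units_interpolation_chromaticL`)
read in valuations give `m + ord_3 L^•(0) = ord_3 ∏c + ord_3 #Ш ≤ ord_3 ∏c + ord_3 #Ш_an = ord_3 L^•(0)`,
so `m = 0`. NO `Surj W 3`, NO integral Kato. PER PAIR; conditional on K1's predicate; closes nothing.
[cite: Sprung2012, Thm. 7.14, Thm. 7.16 (p. 1504) and Main Conj. 7.21 (p. 1505)]
[cite: Sprung2024, §5.2 Lemmas 5.5–5.9 (pp. 40–41)] [cite: Sprung2017, Cor. 4.11] [cite: Miller2011LMS, Def. 1.1] -/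
theorem X8.sprungSharpFlatMainConjecture_of_lowerDivisibility_of_missingUpperBoundAt
    (h714 : thm714_sharpFlatSelmerDual_finite_torsion)
    (h716 : thm716_sharpFlatCharIdeal_divisibility)
    (h59 : lem59AllN_sharpFlatCharValue_rankZero)
    (h3 : realPeriodRat_eq_unit_mul_plusPeriod_three)
    (hGZK : rank_eq_analyticRank_of_analyticRank_le_one) (hmod : hasEntireLFunction_rat)
    (W : WeierstrassCurve ℚ) [W.IsElliptic] [W.IsGloballyMinimal] (p : ℕ) [Fact p.Prime]
    (hX : ClassX8 W p) (h0 : W.analyticRank = 0) (hup : MissingUpperBoundAt W p) (col : Chroma)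
    (hK1 : SprungSharpFlatLowerDivisibility W p col) : SprungSharpFlatMainConjecture W p col := by
  intro κ γ hκ hγ hγ' v hv g hg cneg c hc N hN f ϖ Lsharp Lflat hf hϖ hSP hcol D
  haveI := hN
  obtain ⟨htorD, hfinD, m, hm⟩ :=
    PrintX8MuReading.X8.exists_charIdeal_eq_span_pow_mul_of_lowerDivisibility h714 h716 h3 W p hX col
      hK1 hκ hγ hγ' hv hg hc hf hϖ hSP hcol D
  haveI := hfinD
  have hp3 : p = 3 := hX.1
  subst hp3
  have hp2 : (3 : ℕ) ≠ 2 := by decide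
  have hgood : W.HasGoodReductionAtPrime 3 := hX.2.1.1
  have hdvd : ((3 : ℕ) : ℤ) ∣ W.frobeniusTrace 3 := hX.2.1.2
  have hirr : W.HasIrreducibleModPGaloisRep 3 := ClassX8.irr W 3 hX
  have hL : W.entireLFunction 1 ≠ 0 := (W.analyticRank_eq_zero_iff_holds (hmod W)).1 h0
  -- unit-normalised interpolation `(w · L^•)(0) = L(E,1)/Ω_E` (interpolation constant `1`)
  obtain ⟨w, hP⟩ := exists_units_interpolation_chromaticL W 3 hp2 hgood hf (h3 W hgood hirr f hf) hSP
    col (ClassX8.not_dvd_chromaticConst' W 3 hX col)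
    (((3 : ℕ) : IwasawaAlgebra 3) ^ m * chromaticL col Lsharp Lflat)
  -- (K•) for the generator `3^m · L^•` of `char X^•` (Sprung 2024 Lemmas 5.5–5.9, all levels)
  have hK : (⟨((3 : ℕ) : IwasawaAlgebra 3) ^ m * chromaticL col Lsharp Lflat,
      PowerSeries.C ((w : ℤ_[3]ˣ) : ℤ_[3]) * chromaticL col Lsharp Lflat, 1⟩ :
      SignedDatum W 3).EulerCharacteristic := fun hfin =>
    h59 W 3 hp2 hgood hdvd hL κ γ hκ hγ hγ' v hv g hg cneg c hc col D htorD _ hm hfin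
  obtain ⟨-, hvξ⟩ := valuation_constantCoeff_xi W 3 hGZK hL _ hK
  obtain ⟨t, ht, hLt⟩ := hP
  -- `t = L(E,1)/Ω_E ≠ 0`
  have ht0 : t ≠ 0 := by
    rintro rfl
    have hΩC : (W.realPeriodRat : ℂ) ≠ 0 := Complex.ofReal_ne_zero.mpr W.realPeriodRat_pos_holds.ne'
    apply hL
    have h1 := ht
    rw [Rat.cast_zero, div_eq_iff hΩC] at h1
    simpa using h1
  have hL0 : ((PowerSeries.constantCoeff (PowerSeries.C ((w : ℤ_[3]ˣ) : ℤ_[3]) *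
      chromaticL col Lsharp Lflat) : ℤ_[3]) : ℚ_[3]) ≠ 0 := by
    have h1 := hLt
    simp only [Nat.cast_one, one_mul] at h1
    rw [h1]
    exact_mod_cast ht0
  obtain ⟨-, hvL⟩ := valuation_constantCoeff_L W 3 _ (by show ¬ (3 ∣ 1); omega) hLt hL0
  -- Miller's upper bound read on the rank-`0` witness `#Ш_an = t·#tors²/∏c`
  obtain ⟨q, hq, hqv⟩ := hup
  have hq' : q = t * (W.torsionOrder : ℚ) ^ 2 / (W.tamagawaProduct : ℚ) := by
    have hqq := hq.symm.trans (shaAn_eq_of_analyticRank_eq_zero W hGZK h0 ht)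
    exact_mod_cast hqq
  rw [hq', padicValRat_shaAn_witness W 3 hirr ht0] at hqv
  -- constant terms: `(3^m L^•)(0) = 3^m · L^•(0)`, `(w L^•)(0) = w · L^•(0)`
  have hL00 : ((PowerSeries.constantCoeff (chromaticL col Lsharp Lflat) : ℤ_[3]) : ℚ_[3]) ≠ 0 := by
    intro h0'
    apply hL0
    rw [map_mul, PowerSeries.constantCoeff_C, PadicInt.coe_mul, h0', mul_zero]
  have hvalξ : (((PowerSeries.constantCoeff (((3 : ℕ) : IwasawaAlgebra 3) ^ m *
      chromaticL col Lsharp Lflat) : ℤ_[3]) : ℚ_[3])).valuation =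
      (m : ℤ) + (((PowerSeries.constantCoeff (chromaticL col Lsharp Lflat) : ℤ_[3]) : ℚ_[3])).valuation := by
    have h3m : ((PowerSeries.constantCoeff (((3 : ℕ) : IwasawaAlgebra 3) ^ m *
        chromaticL col Lsharp Lflat) : ℤ_[3]) : ℚ_[3]) =
        ((3 ^ m : ℕ) : ℚ_[3]) * ((PowerSeries.constantCoeff (chromaticL col Lsharp Lflat) : ℤ_[3]) : ℚ_[3]) := by
      rw [map_mul, map_pow, map_natCast, PadicInt.coe_mul, PadicInt.coe_pow, PadicInt.coe_natCast,
        Nat.cast_pow]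
    have hp0 : ((3 ^ m : ℕ) : ℚ_[3]) ≠ 0 := by exact_mod_cast pow_ne_zero m (by decide : (3 : ℕ) ≠ 0)
    rw [h3m, Padic.valuation_mul hp0 hL00, Padic.valuation_natCast, padicValNat.prime_pow]
  have hvalL : (((PowerSeries.constantCoeff (PowerSeries.C ((w : ℤ_[3]ˣ) : ℤ_[3]) *
      chromaticL col Lsharp Lflat) : ℤ_[3]) : ℚ_[3])).valuation =
      (((PowerSeries.constantCoeff (chromaticL col Lsharp Lflat) : ℤ_[3]) : ℚ_[3])).valuation := by
    rw [map_mul, PowerSeries.constantCoeff_C, PadicInt.coe_mul,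
      Padic.valuation_mul (coe_units_ne_zero 3 w) hL00, valuation_coe_units_eq_zero, zero_add]
  -- `m + ord L(0) = ord ∏c + ord #Ш ≤ ord_3 t = ord L(0)`, so `m = 0`
  have hvξ' := hvξ
  simp only at hvξ'
  rw [hvalξ] at hvξ'
  have hvL' := hvL
  simp only at hvL'
  rw [hvalL] at hvL'
  have hm0 : m = 0 := by
    have : (m : ℤ) ≤ 0 := by linarith
    omega
  rw [hm0, pow_zero, one_mul] at hm
  -- the Néron-normalised generator `ϖ̃ · L^•`
  have hϖ1 : ‖(ϖ : ℚ_[3])‖ = 1 := X8_norm_periodRatio_eq_one h3 W 3 hX hf hϖ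
  obtain ⟨hspan', hι''⟩ := span_C_units_mul_eq (PadicInt.mkUnits hϖ1) (chromaticL col Lsharp Lflat)
  refine ⟨htorD, PowerSeries.C ((PadicInt.mkUnits hϖ1 : ℤ_[3]ˣ) : ℤ_[3]) *
    chromaticL col Lsharp Lflat, ?_, ?_⟩
  · rw [hm, hspan']
  · rw [hι'', PadicInt.mkUnits_eq]

/-- **X8 ∧ `r_an = 0`, ANY image: a SETTLED `BSD(E,3)` + K1's predicate ⇒ Sprung's Main Conjecture 7.21
for the colour `•`** (`BSDp ⇒ MissingPPartAt ⇒` the upper bound). The small-image twin of K3's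
`K1Branch.sprungSharpFlatMainConjecture_of_bsdp` (which needs `Surj W 3` for the integral Kato): here
K1's predicate replaces Kato. So at each of the 60 rank-`0` small-image census cells carrying a per-pair
`BSDp` theorem, the ♯/♭ main conjecture follows from K1 ALONE. PER PAIR; conditional; closes nothing.
[cite: Sprung2012, Thm. 7.14, Thm. 7.16 (p. 1504) and Main Conj. 7.21 (p. 1505)]
[cite: Sprung2024, §5.2 Lemmas 5.5–5.9 (pp. 40–41)] [cite: Miller2011LMS, Def. 1.1] -/
theorem X8.sprungSharpFlatMainConjecture_of_lowerDivisibility_of_bsdp_of_analyticRank_eq_zero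
    (h714 : thm714_sharpFlatSelmerDual_finite_torsion)
    (h716 : thm716_sharpFlatCharIdeal_divisibility)
    (h59 : lem59AllN_sharpFlatCharValue_rankZero)
    (h3 : realPeriodRat_eq_unit_mul_plusPeriod_three)
    (hGZK : rank_eq_analyticRank_of_analyticRank_le_one) (hmod : hasEntireLFunction_rat)
    (W : WeierstrassCurve ℚ) [W.IsElliptic] [W.IsGloballyMinimal] (p : ℕ) [Fact p.Prime]
    (hX : ClassX8 W p) (h0 : W.analyticRank = 0) (hB : BSDp W p) (col : Chroma)
    (hK1 : SprungSharpFlatLowerDivisibility W p col) : SprungSharpFlatMainConjecture W p col := by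
  haveI : Finite W.sha := (hGZK W (by omega)).2
  exact X8.sprungSharpFlatMainConjecture_of_lowerDivisibility_of_missingUpperBoundAt h714 h716 h59 h3
    hGZK hmod W p hX h0 (lower_and_upper_of_missingPPartAt W p (missingPPartAt_of_bsdp W p hB)).2 col
    hK1

/-- **CLASS FORM at rank `0`: given K1 BY NAME and the print, on the small-image X8 pairs of analytic
rank `0` the ♯/♭ main conjecture (both colours) is EQUIVALENT to Miller's `BSD(E,3)`.** (⇒: the
image-free rank-zero road of p1, `X8MainConjectureRoad.X8.bsdp_of_sprungSharpFlatMainConjecture_of_analyticRank_eq_zero`,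
Sprung 2024 §5.2; ⇐: the previous theorem.) READING: on 60 of the 61 cells the `Λ`-adic crux 20402 has
NO surplus over the Miller-currency residual R2 of p2 (`CornerX8Print`), given K1; its only genuinely
`Λ`-adic content sits on the small-image pairs of analytic rank `1` (1 census cell). Named inputs:
modularity (`hmodf`), Sprung 2012 Thm. 2.2 / 7.14 / 7.16, Sprung 2024 Lemmas 5.5–5.9, period unit at
`3`, GZK, `hmod`. CONDITIONAL on K1; closes nothing. [cite: Sprung2024, Thm. 5.3 (p. 38) and §5.2 (pp. 39–41)]
[cite: Sprung2012, Thm. 2.2, Thm. 7.14, Thm. 7.16 and Main Conj. 7.21] [cite: Miller2011LMS, Def. 1.1] -/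
theorem sharpFlatMainConjecture_smallImage_rankZero_iff_bsdp_of_K1
    (hmodf : exists_isNewformOf) (h22 : thm22_exists_isHondaSystem)
    (h714 : thm714_sharpFlatSelmerDual_finite_torsion)
    (h716 : thm716_sharpFlatCharIdeal_divisibility)
    (h59 : lem59AllN_sharpFlatCharValue_rankZero)
    (h3 : realPeriodRat_eq_unit_mul_plusPeriod_three)
    (hGZK : rank_eq_analyticRank_of_analyticRank_le_one) (hmod : hasEntireLFunction_rat)
    (hK1 : Theses.PrintX8.SprungLowerDivisibilityAtThree) :
    (∀ (W : WeierstrassCurve ℚ) [W.IsElliptic] [W.IsGloballyMinimal] (p : ℕ) [Fact p.Prime],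
        ClassX8 W p → ¬ Surj W p → W.analyticRank = 0 →
        ∀ col : Chroma, SprungSharpFlatMainConjecture W p col) ↔
      (∀ (W : WeierstrassCurve ℚ) [W.IsElliptic] [W.IsGloballyMinimal] (p : ℕ) [Fact p.Prime],
        ClassX8 W p → ¬ Surj W p → W.analyticRank = 0 → BSDp W p) :=
  ⟨fun hMC W _ _ p _ hX hns h0 ↦
      X8MainConjectureRoad.X8.bsdp_of_sprungSharpFlatMainConjecture_of_analyticRank_eq_zero hmodf h22
        h714 h59 h3 hGZK hmod W p hX h0 (hMC W p hX hns h0),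
    fun hB W _ _ p _ hX hns h0 col ↦
      X8.sprungSharpFlatMainConjecture_of_lowerDivisibility_of_bsdp_of_analyticRank_eq_zero h714 h716
        h59 h3 hGZK hmod W p hX h0 (hB W p hX hns h0) col (hK1 W p hX col)⟩

/-- **THE ANATOMY OF 20402 (class statement).** Given K1 BY NAME and the print (modularity, Sprung 2012
Thms. 2.2 / 7.14 / 7.16, Sprung 2024 Lemmas 5.5–5.9, period unit at `3`, GZK, `hmod`), the crux
`SharpFlatMainConjectureSmallImageX8` is EQUIVALENT to the conjunction of
(r0) Miller's `BSD(E,3)` on the small-image X8 pairs of analytic rank `0` (60 census cells; per pair the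
existing `BSDp` certificate theorems, class-wide OPEN: no Kato engine at image `N_ns(3)`), and
(r1) Sprung's Main Conjecture 7.21 (both colours) on the small-image X8 pairs of analytic rank `1`
(1 census cell; `Λ`-adic; by file A ⟺ the `μ`-bound there). CONDITIONAL on K1; closes nothing.
[cite: Sprung2012, Main Conj. 7.21 (p. 1505)] [cite: Sprung2024, §5.2 (pp. 39–41)] [cite: Miller2011LMS, Def. 1.1] -/
theorem sharpFlatMainConjectureSmallImageX8_iff_bsdp_rankZero_and_mainConjecture_rankOne_of_K1
    (hmodf : exists_isNewformOf) (h22 : thm22_exists_isHondaSystem)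
    (h714 : thm714_sharpFlatSelmerDual_finite_torsion)
    (h716 : thm716_sharpFlatCharIdeal_divisibility)
    (h59 : lem59AllN_sharpFlatCharValue_rankZero)
    (h3 : realPeriodRat_eq_unit_mul_plusPeriod_three)
    (hGZK : rank_eq_analyticRank_of_analyticRank_le_one) (hmod : hasEntireLFunction_rat)
    (hK1 : Theses.PrintX8.SprungLowerDivisibilityAtThree) :
    Theses.PrintX8.SharpFlatMainConjectureSmallImageX8 ↔
      ((∀ (W : WeierstrassCurve ℚ) [W.IsElliptic] [W.IsGloballyMinimal] (p : ℕ) [Fact p.Prime],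
          ClassX8 W p → ¬ Surj W p → W.analyticRank = 0 → BSDp W p) ∧
        (∀ (W : WeierstrassCurve ℚ) [W.IsElliptic] [W.IsGloballyMinimal] (p : ℕ) [Fact p.Prime],
          ClassX8 W p → ¬ Surj W p → W.analyticRank = 1 →
          ∀ col : Chroma, SprungSharpFlatMainConjecture W p col)) := by
  refine ⟨fun hSmall ↦ ⟨fun W _ _ p _ hX hns h0 ↦ ?_, fun W _ _ p _ hX hns h1 col ↦
      hSmall W p hX hns (by omega) col⟩, fun ⟨hB, hMC1⟩ W _ _ p _ hX hns hr col ↦ ?_⟩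
  · exact X8MainConjectureRoad.X8.bsdp_of_sprungSharpFlatMainConjecture_of_analyticRank_eq_zero hmodf
      h22 h714 h59 h3 hGZK hmod W p hX h0 (hSmall W p hX hns (by omega))
  · rcases Nat.lt_or_ge W.analyticRank 1 with hlt | hge
    · have h0 : W.analyticRank = 0 := by omega
      exact X8.sprungSharpFlatMainConjecture_of_lowerDivisibility_of_bsdp_of_analyticRank_eq_zero h714
        h716 h59 h3 hGZK hmod W p hX h0 (hB W p hX hns h0) col (hK1 W p hX col)
    · exact hMC1 W p hX hns (by omega) col

end RankZero

end Summit.BirchSwinnertonDyer.BirchSwinnertonDyer.Theorems.PrintX8SmallImageRankZero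

end
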